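import Literature.Analysis.FluidPDE.OseenSchemeComplex
import Literature.Analysis.FluidPDE.TaoAveragedEuler
import Mathlib.MeasureTheory.Integral.IntervalIntegral.Basic
import Mathlib.MeasureTheory.Group.Integral
import HarnessLib

/-!
# The complexified Oseen scheme at real parameters: restriction to the real scheme

Analysis/FluidPDE support file (everything proved, no definitions), a layer of the proof of the
named fact `Literature.Analysis.FluidPDE.lemarieRieusset2016_local_analyticity`
(`NSBoundedMildAnalytic.lean`; Lemarié-Rieusset 2016, Thm. 9.12, proof pp. 260–263) on top of the
complexified scheme of `OseenSchemeComplex.lean` (root time `m`, `m² = νt`, complex Galilean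
parameter `g`; `freeTermC`, `duhamelC`). It identifies the two operators of the scheme AT REAL
PARAMETERS with the tree's real objects:

* `freeTermC_sqrt_complexify`: for `ν, t > 0` and a real Galilean parameter `g`,
  `freeTermC b (√(νt), cx g) x = cx ((e^{νtΔ} b)(x - νt·g))` — the free term is the Galilean
  transform of the caloric extension `UnboundedOperators.heatExtension b (νt)` (as announced in
  the docstring of `freeTermC`); in particular `freeTermC b (√(νt), 0) x = cx (e^{νtΔ}b (x))`
  (`freeTermC_sqrt_zero`);
* `duhamelC_sqrt_zero`: if `V(√(νσ), 0) = cx ∘ v(σ)` and `W(√(νσ), 0) = cx ∘ w(σ)` on the real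
  time axis `σ ∈ (0, t)`, then `duhamelC ν V W (√(νt), 0) x = cx (B^ν_0(v, w)(t)(x))` with the
  tree's real Duhamel term `oseenDuhamel ν 0` (`NSBoundedMildOseen.lean`) — the substitution
  `σ = θt` (`dσ = t dθ`, `ν(t-σ) = (1-θ)m²`) and `y ↦ x - y`, the complexified kernels restricting
  to the real ones (`heatKernelC_sqrt_complexify`, `oseenKernelC_sqrt_complexify`,
  `OseenKernelComplex.lean`) and `cx` commuting with Bochner integrals (a real linear isometry).

These are the "real points" half of the identification `U|_{real} = u` of the holomorphic
extension with the bounded mild solution (Lemarié-Rieusset 2016, p. 260: on the window the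
solution "is given by" the Oseen series (9.38), whose terms are the real restrictions of the
holomorphic `V_k(τ, z)` of p. 261). Consequences for the iteration (invariant "real on the real
time axis"): the scheme map `V ↦ freeTermC b - duhamelC ν V V` takes a field that is `cx ∘ v` on
the axis to one that is `cx ∘ (e^{ν·Δ}b - B^ν_0(v,v))` there (`scheme_sqrt_zero`), and reality on
the axis passes to pointwise limits (`eq_complexify_realPart_of_tendsto`, the range of `cx` being
closed), the real field being recovered by the tree's coordinatewise `realPart`
(`TaoAveragedEuler.lean`).

## Mathlib / tree search

Tree: `freeTermC`, `duhamelC` (`OseenSchemeComplex.lean`), `heatKernelC_sqrt_complexify`,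
`oseenKernelC_sqrt_complexify`, `complexify_smul` (`OseenKernelComplex.lean`), `oseenDuhamel_apply`
(`NSBoundedMildOseen.lean`), `UnboundedOperators.heatExtension_apply`. Mathlib:
`LinearIsometry.integral_comp_comm` (no integrability needed), `integral_sub_right_eq_self`,
`integral_sub_left_eq_self` (Haar translation / reflection invariance),
`intervalIntegral.integral_comp_mul_right` (`σ = θt`), `integral_Ioc_eq_integral_Ioo`,
`intervalIntegral.integral_of_le`, `Real.sqrt_mul`, `Real.sq_sqrt`,
`Isometry.isClosedEmbedding`, `IsClosed.mem_of_tendsto`.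

## References

* P. G. Lemarié-Rieusset, *The Navier–Stokes Problem in the 21st Century*, CRC Press 2016,
  doi:10.1201/b19556, Thm. 9.12 and its proof, PDF pp. 260–263. [LemarieRieusset2016]
-/

noncomputable section

open MeasureTheory Set Filter Metric Real
open _root_.Topology
open scoped BigOperators

namespace Literature.Analysis.FluidPDE

open Literature.Analysis.FunctionSpaces.EuclideanSpace (complexify complexify_apply norm_complexify)
open UnboundedOperators (heatKernel heatExtension)

variable {ι : Type*} [Fintype ι]

/-! ### `cx` and integrals

`cx` commutes with Bochner integrals with no integrability hypothesis (a real linear isometry into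
a complete space): this is Mathlib's `LinearIsometry.integral_comp_comm`, used below as
`(complexify (ι := ι)).integral_comp_comm`; likewise `cx (v - w) = cx v - cx w` is Mathlib's
`LinearIsometry.map_sub`, used below as `(complexify (ι := ι)).map_sub`. -/

/-- The square of the real root time: `(√(νt))² = νt` in `ℂ` (`νt ≥ 0`). [folklore] -/
theorem ofReal_sqrt_sq {c : ℝ} (hc : 0 ≤ c) : (((Real.sqrt c : ℝ) : ℂ)) ^ 2 = ((c : ℝ) : ℂ) := by
  rw [← Complex.ofReal_pow, Real.sq_sqrt hc]

/-! ### The free term at real parameters -/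

/-- **The free term at real parameters is the Galilean transform of the caloric extension**:
for `ν, t > 0`, a real Galilean parameter `g` and any `x`,
`freeTermC b (√(νt), cx g) x = cx ((e^{νtΔ} b)(x - νt·g))`
(`𝒢(√(νt), cx(y - νtg)) = G_{νt}(y - νtg)` and the translation `y ↦ y + νtg`). [cite: LemarieRieusset2016, Thm. 9.12 (proof, p. 261)] -/
theorem freeTermC_sqrt_complexify {ν t : ℝ} (hν : 0 < ν) (ht : 0 < t)
    (b : EuclideanSpace ℝ ι → EuclideanSpace ℝ ι) (g x : EuclideanSpace ℝ ι) :
    freeTermC b ((((Real.sqrt (ν * t) : ℝ) : ℂ)), complexify g) x =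
      complexify (heatExtension b (ν * t) (x - (ν * t) • g)) := by
  have hνt : 0 < ν * t := mul_pos hν ht
  unfold freeTermC
  simp only
  rw [ofReal_sqrt_sq hνt.le]
  have hker : ∀ y : EuclideanSpace ℝ ι,
      heatKernelC (((Real.sqrt (ν * t) : ℝ) : ℂ)) (complexify y - (((ν * t : ℝ) : ℂ)) • complexify g) •
        complexify (b (x - y)) =
      complexify (heatKernel (ν * t) (y - (ν * t) • g) • b (x - y)) := by
    intro y
    rw [← complexify_smul, ← (complexify (ι := ι)).map_sub, heatKernelC_sqrt_complexify hνt,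
      complexify_smul]
  simp_rw [hker]
  rw [(complexify (ι := ι)).integral_comp_comm, UnboundedOperators.heatExtension_apply]
  congr 1
  -- the translation `y ↦ y + νt g`
  have h := integral_sub_right_eq_self (μ := (volume : Measure (EuclideanSpace ℝ ι)))
    (fun y : EuclideanSpace ℝ ι => heatKernel (ν * t) y • b (x - (ν * t) • g - y)) ((ν * t) • g)
  rw [← h]
  refine integral_congr_ae (Eventually.of_forall fun y => ?_)
  simp only
  congr 2
  abel

/-- **The free term on the real time axis is the caloric extension**:
`freeTermC b (√(νt), 0) x = cx (e^{νtΔ} b (x))` (`ν, t > 0`). [cite: LemarieRieusset2016, Thm. 9.12 (proof, p. 261)] -/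
theorem freeTermC_sqrt_zero {ν t : ℝ} (hν : 0 < ν) (ht : 0 < t)
    (b : EuclideanSpace ℝ ι → EuclideanSpace ℝ ι) (x : EuclideanSpace ℝ ι) :
    freeTermC b ((((Real.sqrt (ν * t) : ℝ) : ℂ)), 0) x = complexify (heatExtension b (ν * t) x) := by
  have h := freeTermC_sqrt_complexify hν ht b 0 x
  rw [map_zero, smul_zero, sub_zero] at h
  exact h

/-! ### The bilinear term on the real time axis -/

/-- Root times multiply: `√(1-θ) √(νt) = √(ν(t - θt))` and `√θ √(νt) = √(ν(θt))` in `ℂ`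
(`θ ≤ 1`, resp. `0 ≤ θ`). [folklore] -/
theorem sqrt_one_sub_mul_sqrt (ν t : ℝ) {θ : ℝ} (hθ1 : θ ≤ 1) :
    (((Real.sqrt (1 - θ) : ℝ) : ℂ)) * (((Real.sqrt (ν * t) : ℝ) : ℂ)) =
      (((Real.sqrt (ν * (t - θ * t)) : ℝ) : ℂ)) := by
  rw [← Complex.ofReal_mul, ← Real.sqrt_mul (by linarith : (0:ℝ) ≤ 1 - θ)]
  congr 2; ring

/-- `√θ √(νt) = √(ν(θt))` in `ℂ` (`θ ≥ 0`). [folklore] -/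
theorem sqrt_mul_sqrt {ν t θ : ℝ} (hθ : 0 ≤ θ) :
    (((Real.sqrt θ : ℝ) : ℂ)) * (((Real.sqrt (ν * t) : ℝ) : ℂ)) =
      (((Real.sqrt (ν * (θ * t)) : ℝ) : ℂ)) := by
  rw [← Complex.ofReal_mul, ← Real.sqrt_mul hθ]
  congr 2; ring

/-- **The substitution `σ = θt` on `(0, 1)`**: `∫_{θ∈(0,1)} f(θt) dθ = t⁻¹ ∫_{σ∈(0,t)} f(σ) dσ`
for `t > 0` (Bochner integrals with values in a real normed space). [folklore] -/
theorem setIntegral_Ioo_comp_mul {F : Type*} [NormedAddCommGroup F] [NormedSpace ℝ F]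
    (f : ℝ → F) {t : ℝ} (ht : 0 < t) :
    ∫ θ in Ioo (0 : ℝ) 1, f (θ * t) = t⁻¹ • ∫ σ in Ioo (0 : ℝ) t, f σ := by
  rw [← integral_Ioc_eq_integral_Ioo, ← intervalIntegral.integral_of_le zero_le_one,
    intervalIntegral.integral_comp_mul_right f ht.ne', zero_mul, one_mul,
    intervalIntegral.integral_of_le ht.le, integral_Ioc_eq_integral_Ioo]

/-- **The bilinear term on the real time axis is the real Duhamel term**: if the fields `V, W`
restrict on the real time axis `(√(νσ), 0)`, `σ ∈ (0, t)`, to real fields `v(σ), w(σ)`, then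
`duhamelC ν V W (√(νt), 0) x = cx (B^ν_0(v, w)(t)(x))`, `B^ν_0 = oseenDuhamel ν 0`
(Lemarié-Rieusset 2016, (9.38): the real window solution is the Oseen expansion, i.e. the
restriction of the holomorphic terms; here: the substitution `σ = θt`, the reflection
`y ↦ x - y`, the real restriction of `𝒦` and `cx ∘ ∫ = ∫ ∘ cx`). [cite: LemarieRieusset2016, Thm. 9.12 (proof, (9.38), pp. 260–261)] -/
theorem duhamelC_sqrt_zero {ν t : ℝ} (hν : 0 < ν) (ht : 0 < t)
    {V W : ℂ × EuclideanSpace ℂ ι → EuclideanSpace ℝ ι → EuclideanSpace ℂ ι}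
    {v w : ℝ → EuclideanSpace ℝ ι → EuclideanSpace ℝ ι}
    (hV : ∀ σ ∈ Ioo 0 t, ∀ z, V ((((Real.sqrt (ν * σ) : ℝ) : ℂ)), 0) z = complexify (v σ z))
    (hW : ∀ σ ∈ Ioo 0 t, ∀ z, W ((((Real.sqrt (ν * σ) : ℝ) : ℂ)), 0) z = complexify (w σ z))
    (x : EuclideanSpace ℝ ι) :
    duhamelC ν V W ((((Real.sqrt (ν * t) : ℝ) : ℂ)), 0) x = complexify (oseenDuhamel ν 0 v w t x) := by
  have hνt : 0 < ν * t := mul_pos hν ht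
  unfold duhamelC
  simp only [smul_zero, sub_zero]
  rw [ofReal_sqrt_sq hνt.le]
  -- the real Duhamel slice
  set J : ℝ → EuclideanSpace ℝ ι := fun σ =>
    ∫ y, oseenKernel (ν * (t - σ)) (x - y) (v σ y) (w σ y) with hJ
  -- the `θ`-integrand on `(0, 1)`
  have hθ : ∀ θ ∈ Ioo (0 : ℝ) 1,
      (((ν * t : ℝ) : ℂ)) • ∫ y, oseenKernelC ((((Real.sqrt (1 - θ) : ℝ) : ℂ)) * (((Real.sqrt (ν * t) : ℝ) : ℂ)))
          (complexify y)
          (V ((((Real.sqrt θ : ℝ) : ℂ)) * (((Real.sqrt (ν * t) : ℝ) : ℂ)), 0) (x - y))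
          (W ((((Real.sqrt θ : ℝ) : ℂ)) * (((Real.sqrt (ν * t) : ℝ) : ℂ)), 0) (x - y)) =
        complexify ((ν * t) • J (θ * t)) := by
    intro θ hθ
    have hσ : θ * t ∈ Ioo 0 t := ⟨mul_pos hθ.1 ht, by nlinarith [hθ.2]⟩
    have hpos : 0 < ν * (t - θ * t) := mul_pos hν (by nlinarith [hθ.2])
    rw [sqrt_one_sub_mul_sqrt ν t hθ.2.le, sqrt_mul_sqrt hθ.1.le]
    have hker : ∀ y : EuclideanSpace ℝ ι,
        oseenKernelC ((((Real.sqrt (ν * (t - θ * t)) : ℝ) : ℂ))) (complexify y)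
          (V ((((Real.sqrt (ν * (θ * t)) : ℝ) : ℂ)), 0) (x - y))
          (W ((((Real.sqrt (ν * (θ * t)) : ℝ) : ℂ)), 0) (x - y)) =
        complexify (oseenKernel (ν * (t - θ * t)) y (v (θ * t) (x - y)) (w (θ * t) (x - y))) := by
      intro y
      rw [hV _ hσ, hW _ hσ, oseenKernelC_sqrt_complexify hpos]
    simp_rw [hker]
    rw [(complexify (ι := ι)).integral_comp_comm, ← complexify_smul]
    congr 2
    -- the reflection `y ↦ x - y`
    simp only [hJ]
    rw [← integral_sub_left_eq_self
      (fun y => oseenKernel (ν * (t - θ * t)) (x - y) (v (θ * t) y) (w (θ * t) y)) volume x]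
    simp only [sub_sub_cancel]
  rw [setIntegral_congr_fun measurableSet_Ioo hθ, (complexify (ι := ι)).integral_comp_comm,
    setIntegral_Ioo_comp_mul (fun σ => (ν * t) • J σ) ht]
  -- scalars: `ν⁻¹ · t⁻¹ · (νt) = 1`
  rw [integral_smul, smul_smul, ← Complex.ofReal_inv, ← complexify_smul, smul_smul]
  have hsc : ν⁻¹ * (t⁻¹ * (ν * t)) = 1 := by field_simp
  rw [hsc, one_smul, oseenDuhamel_apply]

/-! ### The invariant "real on the real time axis" -/

/-- **The scheme map preserves reality on the real time axis**: if `V(√(νσ), 0) = cx ∘ v(σ)` for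
`σ ∈ (0, T₀)`, then for `t ∈ (0, T₀)`,
`freeTermC b (√(νt), 0) x - duhamelC ν V V (√(νt), 0) x = cx (e^{νtΔ}b (x) - B^ν_0(v,v)(t)(x))`
— the next Picard iterate is again real on the axis, and its real restriction is the next REAL
Picard iterate (Lemarié-Rieusset 2016, (9.38): the window solution is the real Oseen expansion).
[cite: LemarieRieusset2016, Thm. 9.12 (proof, (9.38), p. 260)] -/
theorem scheme_sqrt_zero {ν T₀ : ℝ} (hν : 0 < ν)
    {V : ℂ × EuclideanSpace ℂ ι → EuclideanSpace ℝ ι → EuclideanSpace ℂ ι}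
    {v : ℝ → EuclideanSpace ℝ ι → EuclideanSpace ℝ ι}
    (hV : ∀ σ ∈ Ioo 0 T₀, ∀ z, V ((((Real.sqrt (ν * σ) : ℝ) : ℂ)), 0) z = complexify (v σ z))
    (b : EuclideanSpace ℝ ι → EuclideanSpace ℝ ι) {t : ℝ} (ht : t ∈ Ioo 0 T₀)
    (x : EuclideanSpace ℝ ι) :
    freeTermC b ((((Real.sqrt (ν * t) : ℝ) : ℂ)), 0) x -
        duhamelC ν V V ((((Real.sqrt (ν * t) : ℝ) : ℂ)), 0) x =
      complexify (heatExtension b (ν * t) x - oseenDuhamel ν 0 v v t x) := by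
  have hV' : ∀ σ ∈ Ioo 0 t, ∀ z, V ((((Real.sqrt (ν * σ) : ℝ) : ℂ)), 0) z = complexify (v σ z) :=
    fun σ hσ z => hV σ ⟨hσ.1, hσ.2.trans ht.2⟩ z
  rw [freeTermC_sqrt_zero hν ht.1 b x, duhamelC_sqrt_zero hν ht.1 hV' hV' x,
    (complexify (ι := ι)).map_sub]

/-- The range of `cx` is closed (a linear isometry is a closed embedding). [folklore] -/
theorem isClosed_range_complexify :
    IsClosed (range (complexify : EuclideanSpace ℝ ι → EuclideanSpace ℂ ι)) :=
  (complexify (ι := ι)).isometry.isClosedEmbedding.isClosed_range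

/-- A vector in the range of `cx` is the complexification of its real part. [folklore] -/
theorem eq_complexify_realPart_of_mem_range {ζ : EuclideanSpace ℂ ι}
    (h : ζ ∈ range (complexify : EuclideanSpace ℝ ι → EuclideanSpace ℂ ι)) :
    ζ = complexify (realPart ζ) := by
  obtain ⟨v, rfl⟩ := h
  rw [realPart_complexify]

/-- **Reality on the real axis passes to pointwise limits**: if fields `V a` are real at a point,
`V a q z = cx (v a)`, and `V a q z → U q z` along a non-trivial filter, then
`U q z = cx (realPart (U q z))`. [folklore] -/
theorem eq_complexify_realPart_of_tendsto {α : Type*} {l : Filter α} [l.NeBot]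
    {F : α → EuclideanSpace ℂ ι} {ζ : EuclideanSpace ℂ ι}
    (hF : ∀ a, ∃ r : EuclideanSpace ℝ ι, F a = complexify r) (hlim : Tendsto F l (𝓝 ζ)) :
    ζ = complexify (realPart ζ) := by
  refine eq_complexify_realPart_of_mem_range (isClosed_range_complexify.mem_of_tendsto hlim ?_)
  exact Eventually.of_forall fun a => by
    obtain ⟨r, hr⟩ := hF a
    exact ⟨r, hr.symm⟩

/-- **The limit field is real on the real time axis** (the form used by the iteration): if every
`V a` is real on the axis `(√(νt), 0)`, `0 < t < T₀`, and `V a → U` pointwise there, then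
`U(√(νt), 0) z = cx (u t z)` with `u t z = realPart (U(√(νt), 0) z)`. [folklore] -/
theorem real_on_axis_of_tendsto {ν T₀ : ℝ} {α : Type*} {l : Filter α} [l.NeBot]
    {V : α → ℂ × EuclideanSpace ℂ ι → EuclideanSpace ℝ ι → EuclideanSpace ℂ ι}
    {U : ℂ × EuclideanSpace ℂ ι → EuclideanSpace ℝ ι → EuclideanSpace ℂ ι}
    (hV : ∀ a, ∀ t ∈ Ioo 0 T₀, ∀ z, ∃ r : EuclideanSpace ℝ ι,
      V a ((((Real.sqrt (ν * t) : ℝ) : ℂ)), 0) z = complexify r)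
    (hlim : ∀ t ∈ Ioo 0 T₀, ∀ z, Tendsto (fun a => V a ((((Real.sqrt (ν * t) : ℝ) : ℂ)), 0) z) l
      (𝓝 (U ((((Real.sqrt (ν * t) : ℝ) : ℂ)), 0) z))) :
    ∀ t ∈ Ioo 0 T₀, ∀ z,
      U ((((Real.sqrt (ν * t) : ℝ) : ℂ)), 0) z =
        complexify (realPart (U ((((Real.sqrt (ν * t) : ℝ) : ℂ)), 0) z)) :=
  fun t ht z => eq_complexify_realPart_of_tendsto (fun a => hV a t ht z) (hlim t ht z)

end Literature.Analysis.FluidPDE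

end
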